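import Mathlib
import HarnessLib
import Summits.NavierStokesRegularity.NavierStokesRegularity.Theorems.UnthreadedDoorAntidynamoWallL3Corner
import Summits.NavierStokesRegularity.NavierStokesRegularity.Theorems.UnthreadedDoorAntidynamoWallBeltramiFrame

/-!
# Route `UnthreadedDoor` / `ThreadingFlux`, crux `PoloidalLiouville` (stmt-NavierStokesRegularity-1222), antidynamo v2 skeleton (sha16 `4ebf5683127b`),
# WALL `stub_scalarLiouville`: GENERALIZED BELTRAMI (in a constant Galilean frame) AT ACCUMULATING TIMES ⇒ irrotational — core v6

Support file (seat leafhand-ns-unthreadeddoor-2 g3, cell decomp-ns), `--supports stmt-NavierStokesRegularity-1222 --as helper`; theorems only.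

The landed generalized-Beltrami closer (`curl_eq_zero_of_lamb_curlFree`, p817091; far-past form p817183: `curl ((v(t) − b(t)) × curl v(t)) ≡ 0` for
ALL `t` of a far past ⇒ `curl v ≡ 0`, mechanism: drift–heat equation for the vorticity + caloric Liouville + tangency) is upgraded, for a CONSTANT frame
`b`, from «all times of a far past» to «a set of times ACCUMULATING at some `t₀ < 0`»:

* ★★ `curl_eq_zero_of_lamb_curlFree_const_frequently` — in the wall's class (bounded ancient duality-class solution, measurable slices, jointly smooth,
  vorticity tangent to the spheres about `x₀`), if for some constant `b ∈ ℝ³` and some `t₀ < 0` the Lamb vector in the frame `b` is curl-free,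
  `curl ((v(t) − b) × curl v(t)) ≡ 0`, at times `t` accumulating at `t₀`, then `curl v ≡ 0` on `(−∞,0) × ℝ³`.
  Proof: by `CellFlux.unthreadedAnalyticOrIrrotational` (p≤817k, landed) the flow is either irrotational or JOINTLY REAL-ANALYTIC on the slab; then the
  Lamb field `(t,y) ↦ (v(t,y) − b) × curl v(t)(y)` is jointly analytic (`crossCLM` bilinear, `CellFlux.analyticOnNhd_curl_uncurry`), so is its curl, hence
  for every `x` the map `t ↦ curl((v(t) − b) × curl v(t))(x)` is real-analytic on `(−∞,0)` and vanishes frequently near `t₀` — identically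
  (identity theorem on the preconnected `(−∞,0)`), and the all-times closer applies with the constant (smooth) drift `b`.
  In particular: Beltrami (`curl v = λ v`) or steady-Bernoulli structure at accumulating instants, in any fixed inertial frame, is excluded.
* `constant_of_lamb_curlFree_const_frequently` — hence slice-wise constant.
* ★ `stubScalarLiouville_of_core_v6` / `poloidalLiouville_of_core_v6` — CORE v6 = core v5 (`stubScalarLiouville_of_core''''`, p821095) plus the free
  hypothesis (C9) **for no constant frame `b` and no `t₀ < 0` is the Lamb vector `(v − b) × ω` curl-free at times accumulating at `t₀`**.

HONEST LABEL: identity theorem + landed closers; the generic core of the wall (= (ML-a)) is OPEN; nothing here proves `stub_scalarLiouville`,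
`PoloidalLiouville` (1222), or bears on Navier–Stokes regularity; no summit statement is proved (crux 1222 is INCOMPARABLE with the summit).
[folklore] [cite: MajdaBertozziCUP2002, §1.1 (vector identities); KochNadirashviliSereginSverak2009, Thm 5.2 (arXiv:0709.3599 pp. 9–10); LemarieRieusset2016, Thm. 9.12]
-/

noncomputable section

-- the summit and its single sub-problem share the name (CONVENTIONS §1)
set_option linter.dupNamespace false

open scoped Topology InnerProductSpace RealInnerProductSpace ENNReal NNReal
open Filter Set Function Metric MeasureTheory
open Literature.Analysis Literature.Analysis.FluidPDE

namespace Summit.NavierStokesRegularity.NavierStokesRegularity.Theorems.PoloidalLiouville.Antidynamo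

open Summit.NavierStokesRegularity.NavierStokesRegularity.Theorems.PoloidalLiouville
  (toroidalPotential exists_norm_curl_le constantOfIrrotational)
open Summit.NavierStokesRegularity.NavierStokesRegularity.Theorems.PoloidalLiouville.NetFlux (E3)
open Summit.NavierStokesRegularity.NavierStokesRegularity.Theorems.PoloidalLiouville.CellFlux (conjAxis)

namespace OneInstant

/-! ### §1 Joint analyticity of the Lamb field in a constant frame -/

/-- **The Lamb field `(t,y) ↦ (V(t,y) − b) × curl V(t)(y)` of a jointly analytic frame is jointly analytic** (the cross product is the continuous
bilinear map `crossCLM`; the vorticity is jointly analytic by `CellFlux.analyticOnNhd_curl_uncurry`). [folklore] -/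
theorem analyticOnNhd_lamb_uncurry {V : ℝ → E3 → E3} (b : E3)
    (hV : AnalyticOnNhd ℝ (uncurry V) (Iio (0 : ℝ) ×ˢ (univ : Set E3))) :
    AnalyticOnNhd ℝ (uncurry fun t y => cross (V t y - b) (curl (V t) y)) (Iio (0 : ℝ) ×ˢ (univ : Set E3)) := by
  have hω := CellFlux.analyticOnNhd_curl_uncurry hV
  have h1 : AnalyticOnNhd ℝ (fun p : ℝ × E3 => uncurry V p - b) (Iio (0 : ℝ) ×ˢ (univ : Set E3)) :=
    hV.sub analyticOnNhd_const
  have hbil := crossCLM.analyticOnNhd_bilinear (univ : Set (E3 × E3))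
  have h2 := hbil.comp (h1.prod hω) (mapsTo_univ _ _)
  refine h2.congr (isOpen_Iio.prod isOpen_univ) ?_
  rintro ⟨t, y⟩ -
  rfl

/-- **Hence `t ↦ curl((V(t) − b) × curl V(t))(x)` is real-analytic on `(−∞,0)` for every `x`.** [folklore] -/
theorem analyticOnNhd_curl_lamb_slice {V : ℝ → E3 → E3} (b : E3)
    (hV : AnalyticOnNhd ℝ (uncurry V) (Iio (0 : ℝ) ×ˢ (univ : Set E3))) (x : E3) :
    AnalyticOnNhd ℝ (fun t => curl (fun y => cross (V t y - b) (curl (V t) y)) x) (Iio 0) := by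
  have hL := CellFlux.analyticOnNhd_curl_uncurry (V := fun t y => cross (V t y - b) (curl (V t) y))
    (analyticOnNhd_lamb_uncurry b hV)
  intro t ht
  exact (hL (t, x) ⟨ht, mem_univ _⟩).comp₂ analyticAt_id analyticAt_const

/-! ### ★★ §2 Generalized Beltrami in a constant frame at accumulating times -/

/-- ★★ **GENERALIZED BELTRAMI IN A CONSTANT FRAME AT ACCUMULATING TIMES ⇒ IRROTATIONAL.**  Let `v` be a bounded ancient mild solution (`ν = 1`,
duality class) with measurable slices, jointly smooth on `(−∞,0) × ℝ³`, with vorticity tangent to the spheres about `x₀`.  If for some constant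
`b` and some `t₀ < 0` the Lamb vector in the frame `b` is curl-free, `curl ((v(t) − b) × curl v(t)) ≡ 0`, at a set of times accumulating at `t₀`,
then `curl v ≡ 0` on `(−∞,0) × ℝ³`. [cite: KochNadirashviliSereginSverak2009, Thm 5.2 (arXiv:0709.3599 pp. 9–10); LemarieRieusset2016, Thm. 9.12] -/
theorem curl_eq_zero_of_lamb_curlFree_const_frequently
    (v : ℝ → EuclideanSpace ℝ (Fin 3) → EuclideanSpace ℝ (Fin 3)) (x₀ : EuclideanSpace ℝ (Fin 3))
    (hB : Literature.Analysis.FluidPDE.IsBoundedAncientMildSolution 1 v)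
    (hm : ∀ t < 0, AEStronglyMeasurable (v t) volume)
    (hsm : ContDiffOn ℝ (⊤ : ℕ∞) (Function.uncurry v) (Set.Iio 0 ×ˢ Set.univ))
    (hun : ∀ t < 0, ∀ x, ⟪x - x₀, curl (v t) x⟫ = 0)
    (b : EuclideanSpace ℝ (Fin 3))
    (hfr : ∃ t₀ < 0, ∃ᶠ t in 𝓝[≠] t₀, ∀ x, curl (fun y => cross (v t y - b) (curl (v t) y)) x = 0) :
    ∀ t < 0, ∀ x, curl (v t) x = 0 := by
  obtain ⟨t₀, ht₀, hfr⟩ := hfr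
  obtain ⟨K, hK⟩ := exists_norm_curl_le hB hsm
  obtain ⟨T, -, -, hlink⟩ := toroidalPotential v x₀ K hsm hK hun
  rcases CellFlux.unthreadedAnalyticOrIrrotational v x₀ T hB hm hsm hlink with hA | hZ
  · -- analytic continuation in time of the curl-free Lamb identity
    have hall : ∀ t < 0, ∀ x, curl (fun y => cross (v t y - b) (curl (v t) y)) x = 0 := by
      intro t ht x
      have hga := analyticOnNhd_curl_lamb_slice b hA x
      have hgfr : ∃ᶠ s in 𝓝[≠] t₀, (fun s => curl (fun y => cross (v s y - b) (curl (v s) y)) x) s = 0 :=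
        hfr.mono fun s hs => hs x
      have h0 := hga.eqOn_zero_of_preconnected_of_frequently_eq_zero isPreconnected_Iio ht₀ hgfr ht
      simpa only [Pi.zero_apply] using h0
    exact curl_eq_zero_of_lamb_curlFree v x₀ hB hm hsm hun (fun _ => b) contDiffOn_const fun t ht x => hall t ht x
  · exact hZ

/-- ★★ **… HENCE SLICE-WISE CONSTANT.** [cite: KochNadirashviliSereginSverak2009, Thm 5.2 (arXiv:0709.3599 pp. 9–10)] -/
theorem constant_of_lamb_curlFree_const_frequently
    (v : ℝ → EuclideanSpace ℝ (Fin 3) → EuclideanSpace ℝ (Fin 3)) (x₀ : EuclideanSpace ℝ (Fin 3))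
    (hB : Literature.Analysis.FluidPDE.IsBoundedAncientMildSolution 1 v)
    (hm : ∀ t < 0, AEStronglyMeasurable (v t) volume)
    (hsm : ContDiffOn ℝ (⊤ : ℕ∞) (Function.uncurry v) (Set.Iio 0 ×ˢ Set.univ))
    (hun : ∀ t < 0, ∀ x, ⟪x - x₀, curl (v t) x⟫ = 0)
    (b : EuclideanSpace ℝ (Fin 3))
    (hfr : ∃ t₀ < 0, ∃ᶠ t in 𝓝[≠] t₀, ∀ x, curl (fun y => cross (v t y - b) (curl (v t) y)) x = 0) :
    ∀ t < 0, ∃ c : EuclideanSpace ℝ (Fin 3), ∀ x, v t x = c :=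
  constantOfIrrotational v hB hsm (curl_eq_zero_of_lamb_curlFree_const_frequently v x₀ hB hm hsm hun b hfr)

end OneInstant

/-! ### ★ §3 Core v6 -/

/-- ★ **THE CORE OF THE WALL, v6**: core v5 (`stubScalarLiouville_of_core''''`: (C1) analytic frame, (C2) dense vorticity support, (C3') no local flat
direction at any instant, (C6) no local axisymmetry at any instant, (C7) local rigid symmetries only with exact equivariance, (C4') no rigid
anti-symmetry at accumulating times, (C5) not generalized-Beltrami in a smooth Galilean frame on a far past, (C8) not `L³`-close to constants along any
backward sequence) PLUS the free hypothesis (C9) **for no constant frame `b` and no `t₀ < 0` is the Lamb vector `(v(t) − b) × curl v(t)` curl-free at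
times accumulating at `t₀`**. [cite: KochNadirashviliSereginSverak2009, Thm 5.2 (arXiv:0709.3599 pp. 9–10)] -/
theorem stubScalarLiouville_of_core_v6
    (hcore : ∀ (v : ℝ → EuclideanSpace ℝ (Fin 3) → EuclideanSpace ℝ (Fin 3)) (x₀ : EuclideanSpace ℝ (Fin 3))
      (T : ℝ → EuclideanSpace ℝ (Fin 3) → ℝ),
      Literature.Analysis.FluidPDE.IsBoundedAncientMildSolution 1 v →
      (∀ t < 0, AEStronglyMeasurable (v t) volume) →
      ContDiffOn ℝ (⊤ : ℕ∞) (Function.uncurry v) (Set.Iio 0 ×ˢ Set.univ) →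
      ContDiffOn ℝ (⊤ : ℕ∞) (Function.uncurry T) (Set.Iio 0 ×ˢ ({x₀}ᶜ : Set (EuclideanSpace ℝ (Fin 3)))) →
      (∃ C : ℝ, ∀ t < 0, ∀ x, |T t x| ≤ C) →
      (∀ t < 0, ∀ x, Literature.Analysis.FluidPDE.curl (v t) x =
        Literature.Analysis.FluidPDE.cross (gradient (T t) x) (x - x₀)) →
      (∀ t < 0, ∀ x, x ≠ x₀ →
        Literature.Analysis.FluidPDE.cross
            (gradient (fun z => deriv (fun s => T s z) t + inner ℝ (v t z) (gradient (T t) z)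
              - Laplacian.laplacian (T t) z) x) (x - x₀) =
          Literature.Analysis.FluidPDE.cross (gradient (fun z => inner ℝ (v t z) (z - x₀)) x) (gradient (T t) x)) →
      -- (C1) analytic in the given frame
      AnalyticOnNhd ℝ (Function.uncurry v) (Iio (0 : ℝ) ×ˢ (univ : Set (EuclideanSpace ℝ (Fin 3)))) →
      -- (C2) dense non-vanishing of the vorticity at every time
      (∀ t < 0, Dense {x : EuclideanSpace ℝ (Fin 3) | curl (v t) x ≠ 0}) →
      -- (C3') no local flat direction at any instant
      (∀ t < 0, ¬ ∃ e : EuclideanSpace ℝ (Fin 3), e ≠ 0 ∧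
        ∃ U : Set (EuclideanSpace ℝ (Fin 3)), IsOpen U ∧ U.Nonempty ∧ ∀ x ∈ U, ⟪e, curl (v t) x⟫ = 0) →
      -- (C6) no local axisymmetry of the straightened vorticity at any instant, about any axis
      (∀ t < 0, ∀ (R : EuclideanSpace ℝ (Fin 3) ≃ₗᵢ[ℝ] EuclideanSpace ℝ (Fin 3)) (x₁ : EuclideanSpace ℝ (Fin 3))
        (U : Set (EuclideanSpace ℝ (Fin 3))), IsOpen U → U.Nonempty →
        ¬ ∀ θ : ℝ, ∀ y ∈ U, curl (conjAxis R x₁ (v t)) (rotZ θ y) = rotZ θ (curl (conjAxis R x₁ (v t)) y)) →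
      -- (C7) every local rigid symmetry of the vorticity at any instant is an exact equivariance of the velocity about `x₀` at all times
      (∀ t < 0, ∀ (R : EuclideanSpace ℝ (Fin 3) ≃ₗᵢ[ℝ] EuclideanSpace ℝ (Fin 3)) (x₁ : EuclideanSpace ℝ (Fin 3))
        (U : Set (EuclideanSpace ℝ (Fin 3))), IsOpen U → U.Nonempty →
        (∀ y ∈ U, curl (v t) (x₁ + R y) =
          (R : EuclideanSpace ℝ (Fin 3) →L[ℝ] EuclideanSpace ℝ (Fin 3)).det • R (curl (v t) (x₁ + y))) →
        ∀ s < 0, ∀ y, v s (x₀ + R y) = R (v s (x₀ + y))) →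
      -- (C4') not anti-symmetric under any rigid motion at any set of times accumulating inside `(−∞,0)`
      (∀ (R : EuclideanSpace ℝ (Fin 3) ≃ₗᵢ[ℝ] EuclideanSpace ℝ (Fin 3)) (b : EuclideanSpace ℝ (Fin 3)) (t₀ : ℝ), t₀ < 0 →
        ¬ ∃ᶠ t in 𝓝[≠] t₀, ∀ y, curl (v t) (R y + b) =
          -((R : EuclideanSpace ℝ (Fin 3) →L[ℝ] EuclideanSpace ℝ (Fin 3)).det • R (curl (v t) y))) →
      -- (C5) not generalized-Beltrami in any smooth Galilean frame on any far past
      (∀ (t₁ : ℝ), t₁ ≤ 0 → ∀ b : ℝ → EuclideanSpace ℝ (Fin 3), ContDiffOn ℝ (⊤ : ℕ∞) b (Iio t₁) →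
        ¬ ∀ t < t₁, ∀ x, curl (fun y => cross (v t y - b t) (curl (v t) y)) x = 0) →
      -- (C8) not `L³`-close to constants along any sequence of times `τ_k → −∞`
      (¬ ∃ (b : ℕ → EuclideanSpace ℝ (Fin 3)) (τ : ℕ → ℝ) (M : ℝ≥0),
        (∀ k, τ k < 0) ∧ Tendsto τ atTop atBot ∧
        ∀ k, eLpNorm (fun x => v (τ k) x - b k) 3 (volume : Measure (EuclideanSpace ℝ (Fin 3))) ≤ (M : ℝ≥0∞)) →
      -- (C9) NEW: not generalized-Beltrami in any CONSTANT frame at any set of times accumulating inside `(−∞,0)`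
      (∀ (b : EuclideanSpace ℝ (Fin 3)) (t₀ : ℝ), t₀ < 0 →
        ¬ ∃ᶠ t in 𝓝[≠] t₀, ∀ x, curl (fun y => cross (v t y - b) (curl (v t) y)) x = 0) →
      ∀ t < 0, ∀ x, Literature.Analysis.FluidPDE.cross (gradient (T t) x) (x - x₀) = 0) :
    StubScalarLiouville := by
  refine stubScalarLiouville_of_core'''' fun v x₀ T hB hm hsm hT hTb hrep hE hC1 hC2 hC3 hC6 hC7 hC4 hC5 hC8 => ?_
  -- a toroidal field is tangent to the spheres about its centre
  have hun : ∀ t < 0, ∀ x, ⟪x - x₀, curl (v t) x⟫ = 0 := fun t ht x => by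
    rw [hrep t ht x]
    simp [cross, crossProduct, PiLp.inner_apply, Fin.sum_univ_three]
    ring
  by_cases h0 : ∀ t < 0, ∀ x, curl (v t) x = 0
  · intro t ht x
    rw [← hrep t ht x]
    exact h0 t ht x
  -- otherwise (C9) holds by the accumulating-times Beltrami closer
  have hC9 : ∀ (b : EuclideanSpace ℝ (Fin 3)) (t₀ : ℝ), t₀ < 0 →
      ¬ ∃ᶠ t in 𝓝[≠] t₀, ∀ x, curl (fun y => cross (v t y - b) (curl (v t) y)) x = 0 :=
    fun b t₀ ht₀ hfr => h0 (OneInstant.curl_eq_zero_of_lamb_curlFree_const_frequently v x₀ hB hm hsm hun b ⟨t₀, ht₀, hfr⟩)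
  exact hcore v x₀ T hB hm hsm hT hTb hrep hE hC1 hC2 hC3 hC6 hC7 hC4 hC5 hC8 hC9

/-- ★ **… AND THE CRUX from core v6** (route `UnthreadedDoor` decl; composition p793469 by name). -/
theorem poloidalLiouville_of_core_v6
    (hcore : ∀ (v : ℝ → EuclideanSpace ℝ (Fin 3) → EuclideanSpace ℝ (Fin 3)) (x₀ : EuclideanSpace ℝ (Fin 3))
      (T : ℝ → EuclideanSpace ℝ (Fin 3) → ℝ),
      Literature.Analysis.FluidPDE.IsBoundedAncientMildSolution 1 v →
      (∀ t < 0, AEStronglyMeasurable (v t) volume) →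
      ContDiffOn ℝ (⊤ : ℕ∞) (Function.uncurry v) (Set.Iio 0 ×ˢ Set.univ) →
      ContDiffOn ℝ (⊤ : ℕ∞) (Function.uncurry T) (Set.Iio 0 ×ˢ ({x₀}ᶜ : Set (EuclideanSpace ℝ (Fin 3)))) →
      (∃ C : ℝ, ∀ t < 0, ∀ x, |T t x| ≤ C) →
      (∀ t < 0, ∀ x, Literature.Analysis.FluidPDE.curl (v t) x =
        Literature.Analysis.FluidPDE.cross (gradient (T t) x) (x - x₀)) →
      (∀ t < 0, ∀ x, x ≠ x₀ →
        Literature.Analysis.FluidPDE.cross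
            (gradient (fun z => deriv (fun s => T s z) t + inner ℝ (v t z) (gradient (T t) z)
              - Laplacian.laplacian (T t) z) x) (x - x₀) =
          Literature.Analysis.FluidPDE.cross (gradient (fun z => inner ℝ (v t z) (z - x₀)) x) (gradient (T t) x)) →
      AnalyticOnNhd ℝ (Function.uncurry v) (Iio (0 : ℝ) ×ˢ (univ : Set (EuclideanSpace ℝ (Fin 3)))) →
      (∀ t < 0, Dense {x : EuclideanSpace ℝ (Fin 3) | curl (v t) x ≠ 0}) →
      (∀ t < 0, ¬ ∃ e : EuclideanSpace ℝ (Fin 3), e ≠ 0 ∧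
        ∃ U : Set (EuclideanSpace ℝ (Fin 3)), IsOpen U ∧ U.Nonempty ∧ ∀ x ∈ U, ⟪e, curl (v t) x⟫ = 0) →
      (∀ t < 0, ∀ (R : EuclideanSpace ℝ (Fin 3) ≃ₗᵢ[ℝ] EuclideanSpace ℝ (Fin 3)) (x₁ : EuclideanSpace ℝ (Fin 3))
        (U : Set (EuclideanSpace ℝ (Fin 3))), IsOpen U → U.Nonempty →
        ¬ ∀ θ : ℝ, ∀ y ∈ U, curl (conjAxis R x₁ (v t)) (rotZ θ y) = rotZ θ (curl (conjAxis R x₁ (v t)) y)) →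
      (∀ t < 0, ∀ (R : EuclideanSpace ℝ (Fin 3) ≃ₗᵢ[ℝ] EuclideanSpace ℝ (Fin 3)) (x₁ : EuclideanSpace ℝ (Fin 3))
        (U : Set (EuclideanSpace ℝ (Fin 3))), IsOpen U → U.Nonempty →
        (∀ y ∈ U, curl (v t) (x₁ + R y) =
          (R : EuclideanSpace ℝ (Fin 3) →L[ℝ] EuclideanSpace ℝ (Fin 3)).det • R (curl (v t) (x₁ + y))) →
        ∀ s < 0, ∀ y, v s (x₀ + R y) = R (v s (x₀ + y))) →
      (∀ (R : EuclideanSpace ℝ (Fin 3) ≃ₗᵢ[ℝ] EuclideanSpace ℝ (Fin 3)) (b : EuclideanSpace ℝ (Fin 3)) (t₀ : ℝ), t₀ < 0 →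
        ¬ ∃ᶠ t in 𝓝[≠] t₀, ∀ y, curl (v t) (R y + b) =
          -((R : EuclideanSpace ℝ (Fin 3) →L[ℝ] EuclideanSpace ℝ (Fin 3)).det • R (curl (v t) y))) →
      (∀ (t₁ : ℝ), t₁ ≤ 0 → ∀ b : ℝ → EuclideanSpace ℝ (Fin 3), ContDiffOn ℝ (⊤ : ℕ∞) b (Iio t₁) →
        ¬ ∀ t < t₁, ∀ x, curl (fun y => cross (v t y - b t) (curl (v t) y)) x = 0) →
      (¬ ∃ (b : ℕ → EuclideanSpace ℝ (Fin 3)) (τ : ℕ → ℝ) (M : ℝ≥0),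
        (∀ k, τ k < 0) ∧ Tendsto τ atTop atBot ∧
        ∀ k, eLpNorm (fun x => v (τ k) x - b k) 3 (volume : Measure (EuclideanSpace ℝ (Fin 3))) ≤ (M : ℝ≥0∞)) →
      (∀ (b : EuclideanSpace ℝ (Fin 3)) (t₀ : ℝ), t₀ < 0 →
        ¬ ∃ᶠ t in 𝓝[≠] t₀, ∀ x, curl (fun y => cross (v t y - b) (curl (v t) y)) x = 0) →
      ∀ t < 0, ∀ x, Literature.Analysis.FluidPDE.cross (gradient (T t) x) (x - x₀) = 0) :
    Summit.NavierStokesRegularity.NavierStokesRegularity.Theses.UnthreadedDoor.PoloidalLiouville :=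
  poloidalLiouville_of_stubScalarLiouville' (stubScalarLiouville_of_core_v6 hcore)

end Summit.NavierStokesRegularity.NavierStokesRegularity.Theorems.PoloidalLiouville.Antidynamo

end
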